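import Literature.NumberTheory.EllipticCurves.Kim2025.MainIdentityAtAugmentationOPEN
import Literature.NumberTheory.EllipticCurves.LeadingTermPPartProofs
import HarnessLib

/-!
# Kim 2025 (arXiv:2505.09121v1, PREPRINT), Thm. 1.2, last sentence — "In particular, either (rk0) or
# (rk1+ε) implies (IMC at 𝟙)" — for elliptic curves over `ℚ` at a good ordinary `p ≥ 3`, in the kernel
# (theorems only; the inputs are the OPEN `Prop`s of the siblings)

Topic `NumberTheory/EllipticCurves`, sub-directory `Kim2025`. Companion (theorems only: no definition,
no new named fact) of `MainIdentityAtAugmentationOPEN` (the identity at `𝟙`,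
`Kim2025.mainIdentityAtAugmentation`, and the two `_OPEN` clauses of Thm. 1.2) and of
`CorankStructureOPEN` (`thm12_kuriharaVanishingOrder_eq_one_of_analyticRank_eq_one_OPEN`, the clause
(rk1+ε)). Cross-ladder literature-typing layer (cell `bsd-littype`, seat 09, gen 3). HONEST FRAMING:
nothing is asserted; every theorem here is conditional on the preprint's clauses, passed as
hypotheses `h12c`, `h12r`.

## The printed statement (held text `paper:arxiv-2505.09121`, §1.2.2, Thm. 1.2, chunk p0005:L22–L35)

"If one of the following conditions is satisfied: (rk0) `ord_{s=k/2} L(f,s) = 0`, (rk1+ε)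
`ord_{s=k/2} L(f,s) = 1`, `p² ∤ N`, `α_p ≠ β_p` (when `p ∤ N`), and Assumption 1.3 below holds, …
then `δ^{min,†}` does not vanish. Conversely, if `δ^{min,†}` does not vanish, then the Iwasawa main
conjecture for `T_f^†` localized at the augmentation ideal holds. In particular, either (rk0) or
(rk1+ε) implies (IMC at 𝟙)." Proof (p0005:L38): "The (rk0) case is trivial." (`δ^{min}_1 =
λ(1;0,1)/Ω_min = L(f,k/2)/Ω ≠ 0`; for `k = 2` and the tree's normalisation: `δ̃_1 = [0]⁺_f =
L(E,1)/Ω⁺_f`, Kim AJM 148 §1.4.3, tree `kuriharaNumber_one`, `IsNewformOf.entireLFunction_one_eq`.)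

## Contents (all proved; `W/ℚ` globally minimal elliptic, `p ≥ 3` good ordinary, `ρ̄_{E,p^n}` onto
for all `n`, `f` the newform with `Ω⁺_f` integral, `(κ, γ)` cyclotomic in the cyclotomic variable,
`D` any Pontryagin-dual datum of `Sel_{p^∞}(E/ℚ_∞)`)

* `mainIdentityAtAugmentation_of_ratPlusSymbol_zero_ne_zero_of_OPEN` — (rk0) in the modular-symbol
  currency `[0]⁺_f ≠ 0` ⟹ the identity at `𝟙` (GRANTED the converse clause `h12c`): `[0]⁺_f` is
  `p`-integral (`IsNewformOf.not_dvd_den_ratPlusSymbol_div`, `E[p]` irreducible from the tower), so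
  `ord(δ̃) = 0 < ⊤` (`kuriharaVanishingOrder_eq_zero_of_ratPlusSymbol_ne_zero`).
* `mainIdentityAtAugmentation_of_entireLFunction_one_ne_zero_of_OPEN` — (rk0) proper: `L(E,1) ≠ 0`
  gives `[0]⁺_f ≠ 0` by `L(E,1) = [0]⁺_f · Ω⁺_f` (`IsNewformOf.entireLFunction_one_eq`).
* `mainIdentityAtAugmentation_of_analyticRank_eq_one_of_OPEN` — (rk1+ε): `L(E,1) = 0`,
  `ord_{s=1} L(E,s) = 1`, `p² ∤ N_E` (GRANTED the (rk1+ε) clause `h12r` — which needs no (AJ)/(loc_p)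
  in weight `2`, Rem. 1.4 / proof of Cor. 1.10 — and the converse clause `h12c`): `ord(δ̃) = 1 < ⊤`.

References: C.-H. Kim, arXiv:2505.09121v1, Thm. 1.2 and its proof (§1.2.2) [Kim2025RefinedTNC];
C.-H. Kim, Amer. J. Math. 148 (2026) §1.4.3 [Kim2022StructureSelmer]; B. Mazur, J. Tate,
J. Teitelbaum, Invent. Math. 84 (1986) §I.8 (`L(f,1) = [0]⁺·Ω⁺`) [MazurTateTeitelbaum1986Invent].
-/

noncomputable section

open scoped MatrixGroups ModularForm Classical

open CongruenceSubgroup Literature.NumberTheory.EllipticCurves.ModularForms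
  Literature.NumberTheory.EllipticCurves

namespace Literature.NumberTheory.EllipticCurves.Kim2025

variable (W : WeierstrassCurve ℚ) [W.IsElliptic] [W.IsGloballyMinimal] (p : ℕ) [Fact p.Prime]
  {N : ℕ} [NeZero N] (f : CuspForm (Gamma0 N) 2)

/-- **(rk0) ⟹ (IMC at 𝟙), modular-symbol currency.** `p ≥ 3` good ordinary, `ρ̄_{E,p^n}` onto for
all `n`, `f` the newform of `W` with `Ω⁺_f` integral and `[0]⁺_f ≠ 0` (i.e. `δ̃_1 ≠ 0`): then
`ord(δ̃) = 0` — `[0]⁺_f` is `p`-integral since `E[p]` is irreducible and `p` is odd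
(`IsNewformOf.not_dvd_den_ratPlusSymbol_div`) — and the converse clause of Thm. 1.2 (`h12c`, OPEN)
gives the identity at `𝟙` for every Pontryagin-dual datum along the cyclotomic `(κ, γ)`.
[cite: Kim2025RefinedTNC, Thm. 1.2 "(rk0) … implies (IMC at 𝟙)" and "The (rk0) case is trivial" (§1.2.2, chunk p0005:L35–L38) (ANNOUNCED; `h12c` is an OPEN Prop)]
[cite: Kim2022StructureSelmer, §1.4.3 (δ̃_1 = [0]⁺)] -/
theorem mainIdentityAtAugmentation_of_ratPlusSymbol_zero_ne_zero_of_OPEN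
    (h12c : thm12_mainIdentityAtAugmentation_of_kuriharaVanishingOrder_lt_top_OPEN)
    (hp : 3 ≤ p) (htower : ∀ n : ℕ, W.HasSurjectiveModNGaloisRep (p ^ n : ℕ))
    (hord : IsOrdinaryAt W p) (hf : IsNewformOf W f)
    (hint : ∀ r : ℚ, ratPlusSymbol f r ≠ 0 → 0 ≤ padicValRat p (ratPlusSymbol f r))
    (hne : ratPlusSymbol f 0 ≠ 0)
    {κ : ZpExtension ℚ p} {γ : Field.absoluteGaloisGroup ℚ} (hκ : κ.IsCyclotomic)
    (hγ : κ.IsTopGenerator γ) (hγ' : IsCyclotomicVariable p γ) (D : W.SelmerDualData κ γ) :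
    mainIdentityAtAugmentation W p f D := by
  have hp2 : p ≠ 2 := by omega
  have hden : ¬ p ∣ (ratPlusSymbol f 0).den := by
    have h := hf.not_dvd_den_ratPlusSymbol_div hp2 (hasIrreducibleModPGaloisRep_of_tower W p htower)
      (n := 1) (Nat.coprime_one_left N) 0
    simpa using h
  have hlt : kuriharaVanishingOrder W p f < ⊤ := by
    rw [kuriharaVanishingOrder_eq_zero_of_ratPlusSymbol_ne_zero W p f hden hne]
    exact ENat.coe_lt_top 0
  exact mainIdentityAtAugmentation_of_kuriharaVanishingOrder_lt_top_of_OPEN W p f h12c hp htower hord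
    hf hint hlt hκ hγ hγ' D

/-- **(rk0) ⟹ (IMC at 𝟙).** `p ≥ 3` good ordinary, `ρ̄_{E,p^n}` onto for all `n`, `f` the newform of
`W` with `Ω⁺_f` integral, and `L(E,1) ≠ 0`: since `L(E,1) = [0]⁺_f · Ω⁺_f`
(`IsNewformOf.entireLFunction_one_eq`), `[0]⁺_f ≠ 0`, and the previous theorem applies (converse
clause `h12c`, OPEN). [cite: Kim2025RefinedTNC, Thm. 1.2 "(rk0) … implies (IMC at 𝟙)" (§1.2.2, chunk p0005:L35–L38) (ANNOUNCED; `h12c` is an OPEN Prop)]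
[cite: MazurTateTeitelbaum1986Invent, §I.8 (8.6)] -/
theorem mainIdentityAtAugmentation_of_entireLFunction_one_ne_zero_of_OPEN
    (h12c : thm12_mainIdentityAtAugmentation_of_kuriharaVanishingOrder_lt_top_OPEN)
    (hp : 3 ≤ p) (htower : ∀ n : ℕ, W.HasSurjectiveModNGaloisRep (p ^ n : ℕ))
    (hord : IsOrdinaryAt W p) (hf : IsNewformOf W f)
    (hint : ∀ r : ℚ, ratPlusSymbol f r ≠ 0 → 0 ≤ padicValRat p (ratPlusSymbol f r))
    (hL : W.entireLFunction 1 ≠ 0)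
    {κ : ZpExtension ℚ p} {γ : Field.absoluteGaloisGroup ℚ} (hκ : κ.IsCyclotomic)
    (hγ : κ.IsTopGenerator γ) (hγ' : IsCyclotomicVariable p γ) (D : W.SelmerDualData κ γ) :
    mainIdentityAtAugmentation W p f D := by
  have hne : ratPlusSymbol f 0 ≠ 0 := by
    intro h0
    apply hL
    rw [hf.entireLFunction_one_eq, h0]
    simp
  exact mainIdentityAtAugmentation_of_ratPlusSymbol_zero_ne_zero_of_OPEN W p f h12c hp htower hord hf
    hint hne hκ hγ hγ' D

/-- **(rk1+ε) ⟹ (IMC at 𝟙).** `p ≥ 3` with `p² ∤ N_E`, good ordinary, `ρ̄_{E,p^n}` onto for all `n`,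
`L(E,1) = 0` and `ord_{s=1} L(E,s) = 1`, `f` the newform of `W` with `Ω⁺_f` integral: the clause
(rk1+ε) of Thm. 1.2 (`h12r`, OPEN; in weight `2` neither (AJ) nor (loc_p) is an extra hypothesis,
Rem. 1.4 / proof of Cor. 1.10) gives `ord(δ̃) = 1`, and the converse clause (`h12c`, OPEN) gives the
identity at `𝟙` — `length_{(T)} X(E/ℚ_∞) = ord_{T=0} L_p(E,T)` — for every Pontryagin-dual datum
along the cyclotomic `(κ, γ)`.
[cite: Kim2025RefinedTNC, Thm. 1.2 "(rk1+ε) … implies (IMC at 𝟙)" (§1.2.2, chunk p0005:L28, L35), Rem. 1.4 (chunk p0005:L58–L63) (ANNOUNCED; `h12r`, `h12c` are OPEN Props)]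
[cite: BertoliniDarmonVenerucci2022, Thm. A] -/
theorem mainIdentityAtAugmentation_of_analyticRank_eq_one_of_OPEN
    (h12r : thm12_kuriharaVanishingOrder_eq_one_of_analyticRank_eq_one_OPEN)
    (h12c : thm12_mainIdentityAtAugmentation_of_kuriharaVanishingOrder_lt_top_OPEN)
    (hp : 3 ≤ p) (hN : ¬ p ^ 2 ∣ W.conductorNorm ℤ)
    (htower : ∀ n : ℕ, W.HasSurjectiveModNGaloisRep (p ^ n : ℕ)) (hord : IsOrdinaryAt W p)
    (hL : W.entireLFunction 1 = 0) (hrk : W.analyticRank = 1) (hf : IsNewformOf W f)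
    (hint : ∀ r : ℚ, ratPlusSymbol f r ≠ 0 → 0 ≤ padicValRat p (ratPlusSymbol f r))
    {κ : ZpExtension ℚ p} {γ : Field.absoluteGaloisGroup ℚ} (hκ : κ.IsCyclotomic)
    (hγ : κ.IsTopGenerator γ) (hγ' : IsCyclotomicVariable p γ) (D : W.SelmerDualData κ γ) :
    mainIdentityAtAugmentation W p f D := by
  have h1 : kuriharaVanishingOrder W p f = 1 := h12r W p hp hN htower hL hrk f hf hint
  have hlt : kuriharaVanishingOrder W p f < ⊤ := by
    rw [h1]
    exact ENat.coe_lt_top 1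
  exact mainIdentityAtAugmentation_of_kuriharaVanishingOrder_lt_top_of_OPEN W p f h12c hp htower hord
    hf hint hlt hκ hγ hγ' D

end Literature.NumberTheory.EllipticCurves.Kim2025

end
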